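import Summits.KontsevichZagierPeriods.KontsevichZagierPeriods.Theorems.HurwitzMicroSectorsNormalFormPrincipleM2IntegrableLogsDisc
import Summits.KontsevichZagierPeriods.KontsevichZagierPeriods.Theorems.HurwitzMicroSectorsNormalFormPrincipleM2MoebiusKit
import Summits.KontsevichZagierPeriods.KontsevichZagierPeriods.Theorems.HurwitzMicroSectorsNormalFormPrincipleM2DiscSplitKit
import Summits.KontsevichZagierPeriods.KontsevichZagierPeriods.Theorems.HurwitzMicroSectorsNormalFormPrincipleM2DiscPlusSubLogMonomial
import Summits.KontsevichZagierPeriods.KontsevichZagierPeriods.Theorems.HurwitzMicroSectorsNormalFormPrincipleM2DiscMinusSubLogMonomial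
import Summits.KontsevichZagierPeriods.KontsevichZagierPeriods.Theorems.HurwitzMicroSectorsNormalFormPrincipleM2DiscLogMonomialMul
import Summits.KontsevichZagierPeriods.KontsevichZagierPeriods.Theorems.HurwitzMicroSectorsNormalFormPrincipleM2ExistsLogMonomialRepIoo
import Summits.KontsevichZagierPeriods.KontsevichZagierPeriods.Theorems.HurwitzMicroSectorsNormalFormPrincipleM2HalfAngleBaseChange
import Summits.KontsevichZagierPeriods.KontsevichZagierPeriods.Theorems.HurwitzMicroSectorsNormalFormPrincipleM2MoebiusMulKit
import Summits.KontsevichZagierPeriods.KontsevichZagierPeriods.Theorems.HurwitzMicroSectorsNormalFormPrincipleM2MoebiusLifts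
import Summits.KontsevichZagierPeriods.KontsevichZagierPeriods.Theorems.HurwitzMicroSectorsNormalFormPrincipleM2LogMonomialInvIdSplit
import Summits.KontsevichZagierPeriods.KontsevichZagierPeriods.Theorems.HurwitzMicroSectorsNormalFormPrincipleM2CatalanBoxTriangleWedge
import Summits.KontsevichZagierPeriods.KontsevichZagierPeriods.Theorems.HurwitzMicroSectorsNormalFormPrincipleM2ExistsCatalanReps
import Summits.KontsevichZagierPeriods.KontsevichZagierPeriods.Theorems.HurwitzMicroSectorsNormalFormPrincipleM2LogMonomialInvIdSubWedge
import Summits.KontsevichZagierPeriods.KontsevichZagierPeriods.Theorems.HurwitzMicroSectorsCatalanSectorTwoFour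

/-!
# `NormalFormPrinciple` (stmt-KontsevichZagierPeriods-3869), line `SketchIdeator1` — the leaf
# `stub_boxRigidity` in dimension two OFF THE PRODUCT TYPE: `CatalanTwoWays`

Composition (lead seat c8) of the fourteen registered sub-goal stubs of the layer (waves 2–3, all
landed): the box representations `[(0,1)², 1/(1 + x²y²)]` and `[(0,1)², 1/(2 − x² − y²)]` — both of
value Catalan's constant `G = Σ (−1)ⁿ/(2n+1)²` — are KZ-equivalent. This is the strategist's
by-product P2 of crux idea `m2-equal-value-instances` (gen-1 census, N8 lattice experiment): an
instance of Conjecture 1 of Kontsevich–Zagier in dimension two, OFF the product type, that needs no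
transcendence input — only moves of rules (1a), (1b), (2); no Newton–Leibniz, and none of the Clausen
machinery of crux `HurwitzSectorComplement`.

Chain (`a = √(2−x²)`, `t₈ = √2 − 1 = tan(π/8)`, `M_I(g,v) = [{s ∈ I, 1 ≤ t ≤ v(s)}, g(s)/t]`):
* disc side: `1/(2−x²−y²) = 1/(2a(a+y)) + 1/(2a(a−y))` (rule 1b); `[1/(2a(a+y))] ≡ M_(0,1)(1/2a, 1+1/a)`
  (affine `t = 1 + y/a`); `[1/(2a(a−y))] ≡` (reflection `y = 1−θ`) `≡` (fibre substitution)
  `M_(0,1)(1/2a, a/(a−1))`; product rule ⇒ `J = M_(0,1)(1/2a, (a+1)/(a−1))`;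
* half-angle base change `x = 2√2 s/(1+s²)` (`dx/2a = ds/(1+s²)`): `J ≡ M_(0,t₈)(1/(1+s²), c₁c₂)` with the
  Möbius factors `c₁ = (1−t₈s)/(s+t₈) = cot(θ/2+π/8)`, `c₂ = (1+t₈s)/(t₈−s) = cot(π/8−θ/2)`; product rule;
  the Möbius base changes `u = 1/c₁`, `u = 1/c₂` (rotations by `±π/8`, `du/(1+u²) = ds/(1+s²)`) carry the
  pieces onto `M_(t₈,1)` and `M_(0,t₈)` of `(1/(1+u²), 1/u)`; merging the base (rule 1a) gives
  `K = M_(0,1)(1/(1+u²), 1/u)` (value `−∫₀¹ log u/(1+u²) du = G`);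
* Catalan side: `K ≡` (fibre substitution + affine `y = u + θ(1−u)`) `[{u ≤ y ≤ 1}, 1/((1+u²)y)] ≡`
  (swap + null edges) `[{0 ≤ z ≤ x}, 1/(x(1+z²))] ≡` (merge gadget `z = xy`) `[(0,1)², 1/(1+x²y²)]`.
`√2` enters only as an algebraic constant of `ℚ`-semialgebraic data.
References: M. Kontsevich, D. Zagier, *Periods* (2001), §1.2 (rules (1), (2), Conjecture 1).
No definitions are introduced.
-/

noncomputable section

open MeasureTheory Set
open Literature.NumberTheory.Transcendental Literature.NumberTheory.Transcendental.KZ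
open Literature.ModelTheory.ExponentialFields (IsSemialgebraic)

namespace Summit.KontsevichZagierPeriods.HurwitzMicroSectors.NormalFormPrinciple.PiBox.M2

/-! ## The composition `catalanTwoWays` -/

/-- `u ↦ 1/(1+u²)` is `ℚ`-semialgebraic on `(0,1)`. [folklore] -/
theorem isSemialgebraicFunOn_one_div_one_add_sq :
    IsSemialgebraicFunOn ℚ {y : Fin 1 → ℝ | 0 < y 0 ∧ y 0 < 1}
      (fun y => (fun u : ℝ => 1 / (1 + u ^ 2)) (y 0)) := by
  refine (isSemialgebraicFunOn_aeval_div_aeval isSemialgebraic_unitInterval_fin_one 1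
    (1 + MvPolynomial.X 0 ^ 2) fun y _ => ?_).congr fun y _ => by simp
  have : (0:ℝ) < 1 + y 0 ^ 2 := by positivity
  simpa using this.ne'

/-- **`CatalanTwoWays`** (strategist's P2, crux idea `m2-equal-value-instances`): the box representations
`[(0,1)², 1/(1 + x²y²)]` and `[(0,1)², 1/(2 − x² − y²)]` — both of value Catalan's constant `G` — are
KZ-equivalent, by moves of rules (1a), (1b), (2) only (half-angle rationalisation `x = 2√2 s/(1+s²)`,
Möbius rotations by `±π/8`, merge gadget; `√2` enters only as an algebraic constant of `ℚ`-semialgebraic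
data). An instance of the leaf `stub_boxRigidity` in dimension two, off the product type, needing no
transcendence input. [cite: KontsevichZagier2001, §1.2 Conjecture 1] -/
theorem catalanTwoWays (N N' : IntegralRep 2)
    (hNd : N.domain = {x | ∀ i, x i ∈ Set.Ioo (0:ℝ) 1})
    (hNi : EqOn N.integrand (fun x => 1 / (1 + (x 0 * x 1) ^ 2)) N.domain)
    (hN'd : N'.domain = {x | ∀ i, x i ∈ Set.Ioo (0:ℝ) 1})
    (hN'i : EqOn N'.integrand (fun x => 1 / (2 - x 0 ^ 2 - x 1 ^ 2)) N'.domain) :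
    Equivalent N N' := by
  obtain ⟨hIp, hIm, hIJ, hIK⟩ := integrable_logs_disc
  obtain ⟨hIc1, hIc2, hc12, -, -⟩ := moebius_kit
  obtain ⟨hexD0, ⟨Dp, hDpd, hDpi⟩, hexDm, hsplit⟩ := disc_split_kit
  obtain ⟨hsa_g, hsa_vp, hsa_vm, hsa_vJ, hbounds, hdmul⟩ := disc_logMonomial_mul
  obtain ⟨halg, -, -, hsa_f8, hsa_f8', hsa_inv8', hsa_inv8, hsa_c1, hsa_c2, hsa_c12, hmmul⟩ :=
    moebius_mul_kit
  obtain ⟨hlift1, hlift2⟩ := moebius_lifts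
  obtain ⟨htri, hwedge⟩ := catalanBox_triangle_wedge
  obtain ⟨hexC0, ⟨C₁, hC1d, hC1i⟩, ⟨K', hK'd, hK'i⟩⟩ := exists_catalanReps
  obtain ⟨-, hboxband, -, -⟩ := bookkeeping_kit
  -- ### numerical facts about `t₈ = √2 − 1`
  have hr2 : Real.sqrt 2 ^ 2 = 2 := Real.sq_sqrt (by norm_num)
  have hr1 : 1 < Real.sqrt 2 := by
    rw [show (1:ℝ) = Real.sqrt 1 by simp]
    exact Real.sqrt_lt_sqrt (by norm_num) (by norm_num)
  have hr3 : Real.sqrt 2 < 2 := by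
    rw [show (2:ℝ) = Real.sqrt 4 by rw [show (4:ℝ) = 2 ^ 2 by norm_num, Real.sqrt_sq (by norm_num)]]
    exact Real.sqrt_lt_sqrt (by norm_num) (by norm_num)
  have ht0 : 0 < Real.sqrt 2 - 1 := by linarith
  have ht1 : Real.sqrt 2 - 1 < 1 := by linarith
  -- ### the representations
  obtain ⟨D₀, hD0d, hD0i⟩ := hexD0 N' hN'd hN'i
  obtain ⟨Dm, hDmd, hDmi⟩ := hexDm D₀ hD0d (hD0i ▸ fun _ _ => rfl)
  obtain ⟨C₀, hC0d, hC0i⟩ := hexC0 N hNd hNi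
  obtain ⟨Mp, hMpd, hMpi⟩ := exists_logMonomialRep _ _ hsa_g hsa_vp
    (fun x hx => (hbounds x hx).2.2.1) hIp
  obtain ⟨Mm, hMmd, hMmi⟩ := exists_logMonomialRep _ _ hsa_g hsa_vm
    (fun x hx => (hbounds x hx).2.2.2.1) hIm
  obtain ⟨J, hJd, hJi⟩ := exists_logMonomialRep _ _ hsa_g hsa_vJ
    (fun x hx => (hbounds x hx).2.2.2.2) hIJ
  obtain ⟨K, hKd, hKi⟩ := exists_logMonomialRep _ _ isSemialgebraicFunOn_one_div_one_add_sq
    isSemialgebraicFunOn_one_div (fun u hu => by simpa using one_le_one_div hu.1 hu.2.le)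
    (hIK 0 1 le_rfl le_rfl)
  have h1inv8 : ∀ u ∈ Set.Ioo (0:ℝ) (Real.sqrt 2 - 1), 1 ≤ (fun u : ℝ => 1 / u) u := fun u hu => by
    simpa using one_le_one_div hu.1 (hu.2.le.trans ht1.le)
  have h1inv8' : ∀ u ∈ Set.Ioo (Real.sqrt 2 - 1) 1, 1 ≤ (fun u : ℝ => 1 / u) u := fun u hu => by
    simpa using one_le_one_div (ht0.trans hu.1) hu.2.le
  have h1c12 : ∀ s ∈ Set.Ioo (0:ℝ) (Real.sqrt 2 - 1),
      1 ≤ (fun s : ℝ => ((1 - s * (Real.sqrt 2 - 1)) / (s + (Real.sqrt 2 - 1))) *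
        ((1 + (Real.sqrt 2 - 1) * s) / ((Real.sqrt 2 - 1) - s))) s := fun s hs =>
    one_le_mul_of_one_le_of_one_le (hc12 s hs).1 (hc12 s hs).2
  have hIc12 : IntegrableOn (fun s : ℝ => (fun s : ℝ => 1 / (1 + s ^ 2)) s *
      Real.log ((fun s : ℝ => ((1 - s * (Real.sqrt 2 - 1)) / (s + (Real.sqrt 2 - 1))) *
        ((1 + (Real.sqrt 2 - 1) * s) / ((Real.sqrt 2 - 1) - s))) s)) (Set.Ioo (0:ℝ) (Real.sqrt 2 - 1)) := by
    refine (hIc1.add hIc2).congr_fun (fun s hs => ?_) measurableSet_Ioo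
    have h1 := (hc12 s hs).1
    have h2 := (hc12 s hs).2
    simp only [Pi.add_apply]
    rw [Real.log_mul (zero_lt_one.trans_le h1).ne' (zero_lt_one.trans_le h2).ne']
    ring
  obtain ⟨Ms, hMsd, hMsi⟩ := exists_logMonomialRep_Ioo 0 (Real.sqrt 2 - 1) isAlgebraic_zero halg _ _
    hsa_f8 hsa_c12 h1c12 hIc12
  obtain ⟨M₁, hM1d, hM1i⟩ := exists_logMonomialRep_Ioo 0 (Real.sqrt 2 - 1) isAlgebraic_zero halg _ _
    hsa_f8 hsa_c1 (fun s hs => (hc12 s hs).1) hIc1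
  obtain ⟨M₂, hM2d, hM2i⟩ := exists_logMonomialRep_Ioo 0 (Real.sqrt 2 - 1) isAlgebraic_zero halg _ _
    hsa_f8 hsa_c2 (fun s hs => (hc12 s hs).2) hIc2
  obtain ⟨K₁, hK1d, hK1i⟩ := exists_logMonomialRep_Ioo 0 (Real.sqrt 2 - 1) isAlgebraic_zero halg _ _
    hsa_f8 hsa_inv8 h1inv8 (hIK 0 (Real.sqrt 2 - 1) le_rfl ht1.le)
  obtain ⟨K₂, hK2d, hK2i⟩ := exists_logMonomialRep_Ioo (Real.sqrt 2 - 1) 1 halg isAlgebraic_one _ _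
    hsa_f8' hsa_inv8' h1inv8' (hIK (Real.sqrt 2 - 1) 1 ht0.le le_rfl)
  -- ### the relations
  have e0 : of N' - 1 • of D₀ ∈ relations := by
    refine hboxband 1 (fun x => 1 / (2 - x 0 ^ 2 - x 1 ^ 2)) N' D₀ hN'd (fun x hx => ?_) hD0d
      (hD0i ▸ fun _ _ => rfl)
    rw [hN'i hx]
    push_cast
    ring
  have e1 : of D₀ - of Dp - of Dm ∈ relations :=
    hsplit D₀ Dp Dm hD0d (hD0i ▸ fun _ _ => rfl) hDpd (hDpi ▸ fun _ _ => rfl) hDmd (hDmi ▸ fun _ _ => rfl)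
  have e2 : of Dp - of Mp ∈ relations :=
    discPlus_sub_logMonomial Dp Mp hDpd (hDpi ▸ fun _ _ => rfl) hMpd (hMpi ▸ fun _ _ => rfl)
  have e3 : of Dm - of Mm ∈ relations :=
    discMinus_sub_logMonomial Dm Mm hDmd (hDmi ▸ fun _ _ => rfl) hMmd (hMmi ▸ fun _ _ => rfl)
  have e4 : of J - of Mp - of Mm ∈ relations :=
    hdmul J Mp Mm hJd (hJi ▸ fun _ _ => rfl) hMpd (hMpi ▸ fun _ _ => rfl) hMmd (hMmi ▸ fun _ _ => rfl)
  have e5 : of Ms - of J ∈ relations :=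
    halfAngle_baseChange Ms J hMsd (hMsi ▸ fun _ _ => rfl) hJd (hJi ▸ fun _ _ => rfl)
  have e6 : of Ms - of M₁ - of M₂ ∈ relations :=
    hmmul Ms M₁ M₂ hMsd (hMsi ▸ fun _ _ => rfl) hM1d (hM1i ▸ fun _ _ => rfl) hM2d (hM2i ▸ fun _ _ => rfl)
  have e7 : of M₁ - of K₂ ∈ relations :=
    hlift1 M₁ K₂ hM1d (hM1i ▸ fun _ _ => rfl) hK2d (hK2i ▸ fun _ _ => rfl)
  have e8 : of M₂ - of K₁ ∈ relations :=
    hlift2 M₂ K₁ hM2d (hM2i ▸ fun _ _ => rfl) hK1d (hK1i ▸ fun _ _ => rfl)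
  have e9 : of K - of K₁ - of K₂ ∈ relations :=
    logMonomialInvId_split K K₁ K₂ hKd (hKi ▸ fun _ _ => rfl) hK1d (hK1i ▸ fun _ _ => rfl) hK2d
      (hK2i ▸ fun _ _ => rfl)
  have e10 : of K - of K' ∈ relations :=
    logMonomialInvId_sub_wedge K K' hKd (hKi ▸ fun _ _ => rfl) hK'd (hK'i ▸ fun _ _ => rfl)
  have e11 : of C₀ - of C₁ ∈ relations :=
    htri C₀ C₁ hC0d (hC0i ▸ fun _ _ => rfl) hC1d (hC1i ▸ fun _ _ => rfl)
  have e12 : of C₁ - of K' ∈ relations :=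
    hwedge C₁ K' hC1d (hC1i ▸ fun _ _ => rfl) hK'd (hK'i ▸ fun _ _ => rfl)
  have e13 : of N - 1 • of C₀ ∈ relations := by
    refine hboxband 1 (fun x => 1 / (1 + (x 0 * x 1) ^ 2)) N C₀ hNd (fun x hx => ?_) hC0d
      (hC0i ▸ fun _ _ => rfl)
    rw [hNi hx]
    push_cast
    ring
  -- ### linear algebra in `FormalRep`
  have acc : (of N - 1 • of C₀) + (of C₀ - of C₁) + (of C₁ - of K') - (of K - of K')
      + (of K - of K₁ - of K₂) - (of M₂ - of K₁) - (of M₁ - of K₂) - (of Ms - of M₁ - of M₂)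
      + (of Ms - of J) + (of J - of Mp - of Mm) - (of Dp - of Mp) - (of Dm - of Mm)
      - (of D₀ - of Dp - of Dm) - (of N' - 1 • of D₀) ∈ relations :=
    relations.sub_mem (relations.sub_mem (relations.sub_mem (relations.sub_mem (relations.add_mem
      (relations.add_mem (relations.sub_mem (relations.sub_mem (relations.sub_mem (relations.add_mem
      (relations.sub_mem (relations.add_mem (relations.add_mem e13 e11) e12) e10) e9) e8) e7) e6) e5)
      e4) e2) e3) e1) e0
  have key : of N - of N' =
      (of N - 1 • of C₀) + (of C₀ - of C₁) + (of C₁ - of K') - (of K - of K')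
      + (of K - of K₁ - of K₂) - (of M₂ - of K₁) - (of M₁ - of K₂) - (of Ms - of M₁ - of M₂)
      + (of Ms - of J) + (of J - of Mp - of Mm) - (of Dp - of Mp) - (of Dm - of Mm)
      - (of D₀ - of Dp - of Dm) - (of N' - 1 • of D₀) := by
    simp only [one_nsmul]
    abel
  unfold Equivalent
  rw [key]
  exact acc


/-! ## The disc representation joins the Catalan rung `(2,4)` of the route -/

open Summit.KontsevichZagierPeriods.Theorems.HurwitzMicroSectorsCatalanSectorTwoFour
  (catalanSectorTwoFour_proof)

/-- Catalan's box representation on the OPEN box exists (bounded continuous integrand).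
[cite: KontsevichZagier2001, §1.1] -/
theorem exists_catalanBoxRep : ∃ N : IntegralRep 2, N.domain = {x | ∀ i, x i ∈ Set.Ioo (0:ℝ) 1} ∧
    N.integrand = fun x => 1 / (1 + (x 0 * x 1) ^ 2) := by
  have hB := isSemialgebraic_box 2
  have hsa : IsSemialgebraicFunOn ℚ {x : Fin 2 → ℝ | ∀ i, x i ∈ Set.Ioo (0:ℝ) 1}
      (fun x => 1 / (1 + (x 0 * x 1) ^ 2)) := by
    refine (isSemialgebraicFunOn_aeval_div_aeval hB 1 (1 + (MvPolynomial.X 0 * MvPolynomial.X 1) ^ 2)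
      fun x _ => ?_).congr fun x _ => by simp
    have : (0:ℝ) < 1 + (x 0 * x 1) ^ 2 := by positivity
    simpa using this.ne'
  have hmeas : MeasurableSet {x : Fin 2 → ℝ | ∀ i, x i ∈ Set.Ioo (0:ℝ) 1} :=
    Literature.ModelTheory.ExponentialFields.IsSemialgebraic.measurableSet_holds hB
  have hcont : Continuous fun x : Fin 2 → ℝ => 1 / (1 + (x 0 * x 1) ^ 2) := by
    refine Continuous.div continuous_const (by fun_prop) fun x => ?_
    have : (0:ℝ) < 1 + (x 0 * x 1) ^ 2 := by positivity
    exact this.ne'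
  have hint : IntegrableOn (fun x : Fin 2 → ℝ => 1 / (1 + (x 0 * x 1) ^ 2))
      {x : Fin 2 → ℝ | ∀ i, x i ∈ Set.Ioo (0:ℝ) 1} := by
    refine Measure.integrableOn_of_bounded (M := 1) ?_ hcont.aestronglyMeasurable ?_
    · refine (lt_of_le_of_lt (measure_mono PiBox.LevelOne.box_two_subset_Icc) ?_).ne
      rw [Real.volume_Icc_pi]
      simp
    · refine (ae_restrict_iff' hmeas).2 (Filter.Eventually.of_forall fun x _ => ?_)
      have h1 : (1:ℝ) ≤ 1 + (x 0 * x 1) ^ 2 := by nlinarith [sq_nonneg (x 0 * x 1)]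
      rw [Real.norm_eq_abs, abs_of_nonneg (by positivity)]
      exact div_le_one_of_le₀ h1 (by positivity)
  exact ⟨⟨_, _, hB, hsa, hint⟩, rfl, rfl⟩

/-- **The disc representation joins the Catalan rung.** Under the (open) hypothesis of the route's
item `CatalanSectorTwoFour` — `1, π², G` linearly independent over `ℚ` — the off-product
representation `[(0,1)², 1/(2 − x² − y²)]` is KZ-equivalent to EVERY representation of the weight-2
level-4 box sector `[(0,1)², P(xy)/(1 − (xy)⁴)]` (`P ∈ ℚ[t]`) of the same value: unconditionally it is
equivalent to Catalan's box (`catalanTwoWays`), which lies in that sector (`1/(1+t²) = (1−t²)/(1−t⁴)`),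
and the landed `catalanSectorTwoFour_proof` (item stmt-KontsevichZagierPeriods-3877) does the rest.
[cite: KontsevichZagier2001, §1.2 Conjecture 1] -/
theorem disc_equivalent_levelFour_of_value_eq
    (hind : LinearIndependent ℚ
      ![(1 : ℝ), Real.pi ^ 2, (∑' n : ℕ, (-1 : ℝ) ^ n / (2 * (n : ℝ) + 1) ^ 2)])
    (N' r : IntegralRep 2) (P : Polynomial ℚ)
    (hN'd : N'.domain = {x | ∀ i, x i ∈ Set.Ioo (0:ℝ) 1})
    (hN'i : EqOn N'.integrand (fun x => 1 / (2 - x 0 ^ 2 - x 1 ^ 2)) N'.domain)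
    (hrd : r.domain = {x | ∀ i, x i ∈ Set.Ioo (0:ℝ) 1})
    (hri : EqOn r.integrand (fun x => Polynomial.aeval (x 0 * x 1) P / (1 - (x 0 * x 1) ^ 4)) r.domain)
    (hv : N'.value = r.value) : Equivalent N' r := by
  obtain ⟨N, hNd, hNi⟩ := exists_catalanBoxRep
  have e1 : Equivalent N N' := catalanTwoWays N N' hNd (hNi ▸ fun _ _ => rfl) hN'd hN'i
  have hvN : N.value = N'.value := Equivalent.value_eq_holds e1
  have hNi' : EqOn N.integrand (fun x => Polynomial.aeval (x 0 * x 1) (1 - Polynomial.X ^ 2 : Polynomial ℚ) /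
      (1 - (x 0 * x 1) ^ 4)) N.domain := by
    intro x hx
    rw [hNi]
    rw [hNd] at hx
    have h0 := hx 0
    have h1 := hx 1
    have ht : x 0 * x 1 < 1 := mul_lt_one_of_nonneg_of_lt_one_left h0.1.le h0.2 h1.2.le
    have ht0 : 0 ≤ x 0 * x 1 := mul_nonneg h0.1.le h1.1.le
    have h4 : (x 0 * x 1) ^ 4 < 1 := pow_lt_one₀ ht0 ht (by norm_num)
    have hne : (1:ℝ) - (x 0 * x 1) ^ 4 ≠ 0 := (sub_pos.2 h4).ne'
    have hne' : (1:ℝ) + (x 0 * x 1) ^ 2 ≠ 0 := by positivity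
    simp only [map_sub, map_one, map_pow, Polynomial.aeval_X]
    rw [div_eq_div_iff hne' hne]
    ring
  have e2 : Equivalent N r := catalanSectorTwoFour_proof hind N r (1 - Polynomial.X ^ 2) P hNd hrd hNi'
    hri (hvN.trans hv)
  exact e1.symm.trans e2

end Summit.KontsevichZagierPeriods.HurwitzMicroSectors.NormalFormPrinciple.PiBox.M2
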